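import Summits.HodgeConjecture.HodgeConjecture.Theorems.F0P3cStCharTSUpTrWIFHFull           -- ★ (H5‴) p852571: `hJacNC_of_splitDock`; brings ★ (H5″) `…WIFHClosed` (A)-currency head, ★ (H1) `…CartanAllH`
import Summits.HodgeConjecture.HodgeConjecture.Theorems.F0P3cStCharTSUpTrOrbInt             -- ★ (H3d) p852392: `exists_haar_cartanH_compactCore_eq_one`
import Summits.HodgeConjecture.HodgeConjecture.Theorems.F0P3cStCharTSWeylHypMeasure         -- ★ `exists_conjFamily`
import Summits.HodgeConjecture.HodgeConjecture.Theorems.R90S4WeylOrbitalDetermination       -- ★ p862945 (OD-G) (this base, g0): `integrable_mul_of_isLocSmooth_of_locallyIntegrable`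
import HarnessLib

/-!
# R90-TF · S4 (Ch. 13.1–2) · (W6-OD) part 2 — «(ORB-DET) AT EVERY NON-SPLIT PLACE»: on `H_v = U(Φ₂)(L⁺_v) × U(Φ₁)(L⁺_v)`, `v` non-split,
# `G`-regular CANONICAL orbital integrals of a test function determine its integral against every invariant locally integrable density
# (Rogawski 1990 §12.5 p. 182, the Weyl integration formula on `H`; Harish-Chandra 1970 Lemma 42)

Cell `hodgecm-mathlib`, crux H413 (`stmt-HodgeConjecture-24833`, lane `--supports … --as helper`, count-neutral), route of record `HCCMUnconditional`;
programme R90-TF (brief `director/R90-BRIEF.v2.md` 1f40d54518340a35), section S4 = Rogawski Ch. 13.1–2 (base `R90-C131`), hand (W6-OD) (RULING S4-R16) to this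
base: part 1 = ★ p862945 `Theorems/R90S4WeylOrbitalDetermination.lean` (the GENERIC reduction (OD-G), seat g0); this file = part 2 (seat R90-C131-p04 (g2)).
THEOREMS ONLY (no definition, no instance, no notation, no named fact, no `sorry`); ★-only imports; axioms TRIO.

THE SOCKET.  FILE B of S4 (`Cruxes/H413/Lines/R90_S4_HPacketsU2B.lean`, ED. 8 commit abe290537dc8, tree sha16 4d29a03582a94a67) carries the sub-sub-socket
(ORB-DET) `stub_R90_S4_H_orbDetWeyl` :601–:614: for `νH` Haar on `H_v`, `mH` CANONICAL for (`IsLocalGRegular L v`, `νH`), a locally integrable, measurable,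
everywhere conjugation-invariant density `Θ : H_v → ℂ` and test functions `f, f′` (★ `IsLocSmooth`) with `Φ(⟦γ⟧, f) = Φ(⟦γ⟧, f′)` at every `G`-regular `γ`,
`∫ f·Θ dνH = ∫ f′·Θ dνH` — at EVERY finite place `v` of `L⁺`.

THIS FILE proves that display AT EVERY NON-SPLIT PLACE (`hns : ∀ w ∣ v, c • w = w` — the one extra binder; all other binders are the socket's, over the
spelled-out carrier `HLoc L v = (cmDatum L 2 Φ₂).Local v × (cmDatum L 1 Φ₁).Local v`), UNCONDITIONALLY, from the tree's ★ ROAD «UP-TR» (the `H_v`-side Weyl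
integration formula, F0∕P3c line LH6, 2026-09-02): ★ (H5″) `F0P3cStCharTSUpTrWIFHClosed.integral_mul_classFun_eq_finsetSum_weighted_classOrbitalIntegral_H_of_splitSocket`
(the (A)-currency Weyl integration formula on `H_v` over a CARTAN-ALL-H family, compact tube Jacobians paid by ★ (H4c)) with its last socket discharged by ★ (H5‴)
`F0P3cStCharTSUpTrWIFHFull.hJacNC_of_splitDock` (the split Cartan, ★ (H4s) ∘ ★ (B8-D)), at the data of ★ (H1) `F0P3cStCharTSCartanAllH.exists_cartanAllH_weylShape`
(the family: `M_H ∈`, `Z_H(γ₀)`-shape, «`≠ M_H` ⇒ compact», cover, irredundancy), ★ (H3d) `F0P3cStCharTSUpTrOrbInt.exists_haar_cartanH_compactCore_eq_one` (the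
compact-core-normalised Haar measure of each member) and ★ `F0P3cStCharTSWeylHypMeasure.exists_conjFamily` (conjugation charts; members abelian by ★ `hab_holds`).

THE MATHEMATICS ([Rogawski1990, §12.5 p. 182]: «`∫_H f(h) α(h) dh = Σ_T |Ω(T,H)|⁻¹ ∫_T D_H(t)² Φ(t, f) α(t) dt`» for class functions `α`).  The tree's ★ (H5″) states the
right-hand side as a finite sum of SET integrals over the `G`-REGULAR part `{t ∈ T | ι_v(t) regular}` of each Cartan representative, with the CANONICAL class orbital
integral `classOrbitalIntegral mH f ⟦t⟧` as `Φ(t, f)`.  Apply it to `(f, Θ)` and to `(f′, Θ)`: the two right-hand sides have, term by term, integrands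
`w(t) • (Θ(t) · Φ(⟦t⟧, f))` and `w(t) • (Θ(t) · Φ(⟦t⟧, f′))` which AGREE POINTWISE on the domain of integration by the hypothesis `Φ(⟦γ⟧, f) = Φ(⟦γ⟧, f′)` for
`G`-regular `γ` — so the sums are equal (`Finset.sum_congr` + `setIntegral_congr_fun`).  No conullity of the singular set and no torus-side integrability enter at
this currency (they are inside ★ (H5″)); the side conditions of ★ (H5″) are: `f` measurable (a test function is locally constant, hence continuous), `Θ` a class
function on the `G`-regular set (it is one everywhere), `f·Θ ∈ L¹(νH)` (★ (OD-G) `integrable_mul_of_isLocSmooth_of_locallyIntegrable`: compact support × `L¹_loc`).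
* §1 `integral_mul_eq_of_classOrbitalIntegral_eq_of_isLocSmooth_nonsplit` — THE HEAD: the socket's display under `hns`, binders in the socket's order with `hns`
  inserted after `v` (so FILE B can pay a non-split cut of (ORB-DET) by the term `fun L _ _ _ v hns _ _ _ _ νH _ _ mH hm Θ hΘi hΘm hΘinv f f' hf hf' hO => …` BY NAME).
  The binder `LocallyIntegrable Θ νH` is used (integrability of `f·Θ`); `Measurable Θ` is carried for byte-agreement with the socket and NOT used (★ (H5″) needs
  measurability of `f`, not of `α`) — whence the leading underscore.

CENSUS CORRECTION (to this base's `R90/R90-C131-p04/g0/MEMO-ORBDET-H-road.v1.md` e125775245c769f4, §«NOT in the tree»): the `H_v` twin of the Weyl integration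
formula IS in the tree at non-split places — ROAD «UP-TR» bricks (H1) CARTAN-ALL-H, (H2) SINGULAR-NULL-H, (H3a–e), (H4c)∕(H4s), (H5)–(H5‴), (A0-H) — so the memo's
bricks (OD-1)…(OD-6) are needed only at SPLIT places (`H_v ≅ GL₂(L⁺_v) × GL₁(L⁺_v)`), which is what remains of (ORB-DET) after this file.

HONEST LABEL: count-neutral helper (lane `--supports`); it pays the (ORB-DET) display at non-split `v` only — the socket `stub_R90_S4_H_orbDetWeyl` quantifies over
ALL finite `v` and stays OPEN until the split-place half is built (or the pen cuts the socket); nothing here touches (HC-LI) `stub_R90_S4_H_charLocIntHC`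
(Harish-Chandra's local integrability, the other open socket of FILE B).  HC_CM is proved only modulo the 7 printed citations (2 remaining named inputs: hLiu418 =
`stmt-HodgeConjecture-24832`, h413 = `stmt-HodgeConjecture-24833`) until rung 0 closes.  REL ≠ ★ ≠ BUILT.

## References
* [Rogawski1990] J. D. Rogawski, *Automorphic Representations of Unitary Groups in Three Variables*, Ann. of Math. Stud. 123 (1990): §12.5 pp. 182–183
  (the Weyl integration formula on `G` and on `H`, Lemma 12.5.1); §4.1 pp. 39–40 (invariant distributions, orbital integrals); §4.3 (4.3.1) pp. 42–43
  (`G`-regular elements of `H`, normalisation of measures); §3.6 pp. 28–31 (`Ω(T, H)`).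
* [HarishChandra1970] Harish-Chandra (notes by G. van Dijk), *Harmonic analysis on reductive p-adic groups*, LNM 162 (1970), Lemma 22, Lemma 42.
* [DeitmarEchterhoff2014] A. Deitmar, S. Echterhoff, *Principles of Harmonic Analysis*, 2nd ed. (2014), Thm. 1.5.3 (quotient integral formula).
-/

set_option autoImplicit false
-- the mandated namespace repeats the single-problem summit's segment (`HodgeConjecture.HodgeConjecture`)
set_option linter.dupNamespace false

noncomputable section

open MeasureTheory Measure Set Filter Topology Function NumberField IsDedekindDomain
open Literature.MeasureTheory.Group
open Literature.NumberTheory.Automorphic Literature.NumberTheory.Automorphic.UnitaryGroup Literature.NumberTheory.Rogawski1990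
open Summit.HodgeConjecture.HodgeConjecture.Cruxes.H413
open scoped ENNReal NNReal MatrixGroups Pointwise

namespace Summit.HodgeConjecture.HodgeConjecture.R90.S4

/-! ## §1 (ORB-DET) at a non-split place, from the ★ Weyl integration formula on `H_v` -/

/-- **(ORB-DET) AT A NON-SPLIT PLACE — «`G`-regular canonical orbital integrals determine the integral against any invariant locally integrable density».**
Let `v` be a finite place of `L⁺` that does not split in `L` (`hns`), `νH` a Haar measure on `H_v = U(Φ₂)(L⁺_v) × U(Φ₁)(L⁺_v)`, `mH` an orbital-measure family
CANONICAL for the `G`-regular classes and `νH` (★ `OrbitalMeasureFamily.IsCanonical`), `Θ : H_v → ℂ` locally integrable, (measurable,) and conjugation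
invariant, and `f, f′ ∈ C_c^∞(H_v)` (★ `IsLocSmooth`) with `classOrbitalIntegral mH f ⟦γ⟧ = classOrbitalIntegral mH f′ ⟦γ⟧` at every `G`-regular `γ`.  Then
`∫ f·Θ dνH = ∫ f′·Θ dνH`.  Proof: the Weyl integration formula on `H_v` (★ (H5″) (A)-currency, last socket paid by ★ (H5‴), at the CARTAN-ALL-H data of ★ (H1),
★ (H3d), ★ `exists_conjFamily`) writes both sides as `Σ_T [N_H(T):T]⁻¹ • ∫_{t ∈ T^{G-reg}} D_H(t)² • (Θ(t) · Φ(⟦t⟧, ·)) dt`, and the integrands agree pointwise on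
the `G`-regular part.  The display is FILE B's `stub_R90_S4_H_orbDetWeyl` (ED. 8 :601–:613) with the single extra binder `hns`.
[cite: Rogawski1990, §12.5 pp. 182–183; §4.1 pp. 39–40; §4.3 (4.3.1) p. 43] [cite: HarishChandra1970, Lemma 42] -/
theorem integral_mul_eq_of_classOrbitalIntegral_eq_of_isLocSmooth_nonsplit
    (L : Type) [Field L] [NumberField L] [IsCMField L] (v : HeightOneSpectrum (𝓞 ↥(maximalRealSubfield L)))
    (hns : ∀ w : PlacesOver L v, IsCMField.complexConj L • w.1 = w.1)
    [MeasurableSpace ((cmDatum L 2 (Matrix.of fun i j : Fin 2 => if i.val + j.val + 1 = 2 then (1 : L) else 0)).Local v ×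
      (cmDatum L 1 (Matrix.of fun i j : Fin 1 => if i.val + j.val + 1 = 1 then (1 : L) else 0)).Local v)]
    [BorelSpace ((cmDatum L 2 (Matrix.of fun i j : Fin 2 => if i.val + j.val + 1 = 2 then (1 : L) else 0)).Local v ×
      (cmDatum L 1 (Matrix.of fun i j : Fin 1 => if i.val + j.val + 1 = 1 then (1 : L) else 0)).Local v)]
    [∀ a : ((cmDatum L 2 (Matrix.of fun i j : Fin 2 => if i.val + j.val + 1 = 2 then (1 : L) else 0)).Local v ×
        (cmDatum L 1 (Matrix.of fun i j : Fin 1 => if i.val + j.val + 1 = 1 then (1 : L) else 0)).Local v),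
      MeasurableSpace (((cmDatum L 2 (Matrix.of fun i j : Fin 2 => if i.val + j.val + 1 = 2 then (1 : L) else 0)).Local v ×
        (cmDatum L 1 (Matrix.of fun i j : Fin 1 => if i.val + j.val + 1 = 1 then (1 : L) else 0)).Local v) ⧸
        Subgroup.centralizer ({a} : Set ((cmDatum L 2 (Matrix.of fun i j : Fin 2 => if i.val + j.val + 1 = 2 then (1 : L) else 0)).Local v ×
        (cmDatum L 1 (Matrix.of fun i j : Fin 1 => if i.val + j.val + 1 = 1 then (1 : L) else 0)).Local v)))]
    [∀ a : ((cmDatum L 2 (Matrix.of fun i j : Fin 2 => if i.val + j.val + 1 = 2 then (1 : L) else 0)).Local v ×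
        (cmDatum L 1 (Matrix.of fun i j : Fin 1 => if i.val + j.val + 1 = 1 then (1 : L) else 0)).Local v),
      BorelSpace (((cmDatum L 2 (Matrix.of fun i j : Fin 2 => if i.val + j.val + 1 = 2 then (1 : L) else 0)).Local v ×
        (cmDatum L 1 (Matrix.of fun i j : Fin 1 => if i.val + j.val + 1 = 1 then (1 : L) else 0)).Local v) ⧸
        Subgroup.centralizer ({a} : Set ((cmDatum L 2 (Matrix.of fun i j : Fin 2 => if i.val + j.val + 1 = 2 then (1 : L) else 0)).Local v ×
        (cmDatum L 1 (Matrix.of fun i j : Fin 1 => if i.val + j.val + 1 = 1 then (1 : L) else 0)).Local v)))]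
    (νH : Measure ((cmDatum L 2 (Matrix.of fun i j : Fin 2 => if i.val + j.val + 1 = 2 then (1 : L) else 0)).Local v ×
      (cmDatum L 1 (Matrix.of fun i j : Fin 1 => if i.val + j.val + 1 = 1 then (1 : L) else 0)).Local v))
    [νH.IsHaarMeasure] [νH.IsMulRightInvariant]
    (mH : OrbitalMeasureFamily ((cmDatum L 2 (Matrix.of fun i j : Fin 2 => if i.val + j.val + 1 = 2 then (1 : L) else 0)).Local v ×
      (cmDatum L 1 (Matrix.of fun i j : Fin 1 => if i.val + j.val + 1 = 1 then (1 : L) else 0)).Local v))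
    (hm : mH.IsCanonical (IsLocalGRegular L v) νH)
    (Θ : ((cmDatum L 2 (Matrix.of fun i j : Fin 2 => if i.val + j.val + 1 = 2 then (1 : L) else 0)).Local v ×
      (cmDatum L 1 (Matrix.of fun i j : Fin 1 => if i.val + j.val + 1 = 1 then (1 : L) else 0)).Local v) → ℂ)
    (hΘi : LocallyIntegrable Θ νH) (_hΘm : Measurable Θ)
    (hΘinv : ∀ x g : ((cmDatum L 2 (Matrix.of fun i j : Fin 2 => if i.val + j.val + 1 = 2 then (1 : L) else 0)).Local v ×
      (cmDatum L 1 (Matrix.of fun i j : Fin 1 => if i.val + j.val + 1 = 1 then (1 : L) else 0)).Local v), Θ (x * g * x⁻¹) = Θ g)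
    (f f' : ((cmDatum L 2 (Matrix.of fun i j : Fin 2 => if i.val + j.val + 1 = 2 then (1 : L) else 0)).Local v ×
      (cmDatum L 1 (Matrix.of fun i j : Fin 1 => if i.val + j.val + 1 = 1 then (1 : L) else 0)).Local v) → ℂ)
    (hf : IsLocSmooth f) (hf' : IsLocSmooth f')
    (hO : ∀ γ, IsLocalGRegular L v γ → classOrbitalIntegral mH f (ConjClasses.mk γ) = classOrbitalIntegral mH f' (ConjClasses.mk γ)) :
    MeasureTheory.integral νH (fun g => f g * Θ g) = MeasureTheory.integral νH (fun g => f' g * Θ g) := by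
  -- ### (H1) the CARTAN-ALL-H family in the Weyl-cover letters
  obtain ⟨SH, -, hZ, hcpt, hcov, hnc⟩ := F0P3cStCharTSCartanAllH.exists_cartanAllH_weylShape L v hns
  -- ### (H3d) the torus measures: THE compact-core-normalised Haar measure on each member of `SH`, `0` elsewhere
  have htex : ∀ T : Subgroup ((cmDatum L 2 (Matrix.of fun i j : Fin 2 => if i.val + j.val + 1 = 2 then (1 : L) else 0)).Local v ×
      (cmDatum L 1 (Matrix.of fun i j : Fin 1 => if i.val + j.val + 1 = 1 then (1 : L) else 0)).Local v),
      ∃ t : Measure ↥T, T ∈ SH → t.IsHaarMeasure ∧ t.IsInvInvariant ∧ t (compactCore ↥T) = 1 := by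
    intro T
    by_cases hT : T ∈ SH
    · obtain ⟨γ₀, hγ₀, hTe⟩ := hZ T hT
      obtain ⟨t, ht1, ht2, ht3⟩ := F0P3cStCharTSUpTrOrbInt.exists_haar_cartanH_compactCore_eq_one hγ₀ hTe
      exact ⟨t, fun _ => ⟨ht1, ht2, ht3⟩⟩
    · exact ⟨0, fun h => absurd h hT⟩
  choose tH htHpkg using htex
  have htHh : ∀ T ∈ SH, (tH T).IsHaarMeasure := fun T hT => (htHpkg T hT).1
  have htHinv : ∀ T ∈ SH, (tH T).IsInvInvariant := fun T hT => (htHpkg T hT).2.1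
  have htH : ∀ T ∈ SH, tH T (compactCore ↥T) = 1 := fun T hT => (htHpkg T hT).2.2
  -- ### conjugation families of the (abelian, ★ `hab_holds`) members
  have hΦex : ∀ T : ↥SH, ∃ Φ : (((cmDatum L 2 (Matrix.of fun i j : Fin 2 => if i.val + j.val + 1 = 2 then (1 : L) else 0)).Local v ×
        (cmDatum L 1 (Matrix.of fun i j : Fin 1 => if i.val + j.val + 1 = 1 then (1 : L) else 0)).Local v) ⧸
        (T : Subgroup ((cmDatum L 2 (Matrix.of fun i j : Fin 2 => if i.val + j.val + 1 = 2 then (1 : L) else 0)).Local v ×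
          (cmDatum L 1 (Matrix.of fun i j : Fin 1 => if i.val + j.val + 1 = 1 then (1 : L) else 0)).Local v))) ×
        ↥(T : Subgroup ((cmDatum L 2 (Matrix.of fun i j : Fin 2 => if i.val + j.val + 1 = 2 then (1 : L) else 0)).Local v ×
          (cmDatum L 1 (Matrix.of fun i j : Fin 1 => if i.val + j.val + 1 = 1 then (1 : L) else 0)).Local v)) →
        ((cmDatum L 2 (Matrix.of fun i j : Fin 2 => if i.val + j.val + 1 = 2 then (1 : L) else 0)).Local v ×
          (cmDatum L 1 (Matrix.of fun i j : Fin 1 => if i.val + j.val + 1 = 1 then (1 : L) else 0)).Local v),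
      ∀ (x : ((cmDatum L 2 (Matrix.of fun i j : Fin 2 => if i.val + j.val + 1 = 2 then (1 : L) else 0)).Local v ×
          (cmDatum L 1 (Matrix.of fun i j : Fin 1 => if i.val + j.val + 1 = 1 then (1 : L) else 0)).Local v))
        (t : ↥(T : Subgroup ((cmDatum L 2 (Matrix.of fun i j : Fin 2 => if i.val + j.val + 1 = 2 then (1 : L) else 0)).Local v ×
          (cmDatum L 1 (Matrix.of fun i j : Fin 1 => if i.val + j.val + 1 = 1 then (1 : L) else 0)).Local v))),
        Φ (QuotientGroup.mk x, t) = x * t * x⁻¹ := by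
    intro T
    obtain ⟨γ₀, hγ₀, hTe⟩ := hZ T.1 T.2
    exact F0P3cStCharTSWeylHypMeasure.exists_conjFamily _ (F0P3cStCharTSUpTrWIFHInst.hab_holds hγ₀ hTe)
  choose Φ hΦ using hΦex
  -- ### the per-member instances, then the (A)-currency Weyl integration formula on `H_v` with NO socket left (★ (H5″) ∘ ★ (H5‴))
  haveI hHi : ∀ T : ↥SH, (tH (T : Subgroup ((cmDatum L 2 (Matrix.of fun i j : Fin 2 => if i.val + j.val + 1 = 2 then (1 : L) else 0)).Local v ×
      (cmDatum L 1 (Matrix.of fun i j : Fin 1 => if i.val + j.val + 1 = 1 then (1 : L) else 0)).Local v))).IsHaarMeasure := fun T => htHh T.1 T.2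
  haveI hIi : ∀ T : ↥SH, (tH (T : Subgroup ((cmDatum L 2 (Matrix.of fun i j : Fin 2 => if i.val + j.val + 1 = 2 then (1 : L) else 0)).Local v ×
      (cmDatum L 1 (Matrix.of fun i j : Fin 1 => if i.val + j.val + 1 = 1 then (1 : L) else 0)).Local v))).IsInvInvariant := fun T => htHinv T.1 T.2
  have hWIF := fun (φ : ((cmDatum L 2 (Matrix.of fun i j : Fin 2 => if i.val + j.val + 1 = 2 then (1 : L) else 0)).Local v ×
        (cmDatum L 1 (Matrix.of fun i j : Fin 1 => if i.val + j.val + 1 = 1 then (1 : L) else 0)).Local v) → ℂ)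
      (hφm : Measurable φ) (hφΘ : Integrable (fun y => φ y * Θ y) νH) =>
    F0P3cStCharTSUpTrWIFHClosed.integral_mul_classFun_eq_finsetSum_weighted_classOrbitalIntegral_H_of_splitSocket hns νH SH hZ hcov hnc Φ hΦ
      (fun T => tH (T : Subgroup ((cmDatum L 2 (Matrix.of fun i j : Fin 2 => if i.val + j.val + 1 = 2 then (1 : L) else 0)).Local v ×
        (cmDatum L 1 (Matrix.of fun i j : Fin 1 => if i.val + j.val + 1 = 1 then (1 : L) else 0)).Local v)))
      (fun T => htH T.1 T.2)
      (F0P3cStCharTSUpTrWIFHFull.hJacNC_of_splitDock hns νH SH hZ hcpt Φ hΦ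
        (fun T => tH (T : Subgroup ((cmDatum L 2 (Matrix.of fun i j : Fin 2 => if i.val + j.val + 1 = 2 then (1 : L) else 0)).Local v ×
          (cmDatum L 1 (Matrix.of fun i j : Fin 1 => if i.val + j.val + 1 = 1 then (1 : L) else 0)).Local v)))
        (fun T => htH T.1 T.2))
      hm φ Θ hφm (fun x t _ => hΘinv x t) hφΘ
  -- ### both sides through the formula; the integrands agree pointwise on the `G`-regular part of every Cartan representative
  rw [hWIF f hf.1.continuous.measurable (integrable_mul_of_isLocSmooth_of_locallyIntegrable νH hf hΘi),
    hWIF f' hf'.1.continuous.measurable (integrable_mul_of_isLocSmooth_of_locallyIntegrable νH hf' hΘi)]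
  refine Finset.sum_congr rfl fun T _ => ?_
  congr 1
  refine setIntegral_congr_fun (F0P3cStCharTSUpTrWIFH.measurableSet_setOf_isLocalGRegular_subtype hns _) fun t ht => ?_
  simp only [Set.mem_setOf_eq] at ht
  simp only [hO _ ht]

end Summit.HodgeConjecture.HodgeConjecture.R90.S4

end
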